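import Mathlib
import Literature.NumberTheory.Transcendental.SemialgebraicLineDeriv

/-!
# `RichelotChain` (stmt-KontsevichZagierPeriods-6732, route IsogenyCertificates): roots of a quadratic pencil

Elementary real analysis of the branch functions of a (2,2)-correspondence `Φ(x, t) = 0` that is
quadratic in the fibre variable: for coefficient functions `a, b, c : ℝ → ℝ` the two roots
`x_ε(t) = (−b(t) + ε√(b(t)² − 4a(t)c(t)))/(2a(t))`, `ε = ±1`, of `a(t)x² + b(t)x + c(t)`:

* they are roots, `2a·x_ε + b = ε√disc`, and every root is one of them (`quadRoot_isRoot`,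
  `two_mul_quadRoot_add`, `root_cases`, `roots_eq_of_lt`);
* `x_ε` is differentiable where `a ≠ 0`, `disc > 0`, with derivative given by implicit
  differentiation, `x_ε′ = −(a′x² + b′x + c′)/(2ax + b)` (`hasDerivAt_quadRoot`, proved by
  differentiating the identity `a x_ε² + b x_ε + c ≡ 0` near `t` and uniqueness of derivatives —
  no derivative of `√` is computed by hand);
* `p ↦ x_ε(p 0)` and the implicit derivative are `ℚ`-semialgebraic when `a, b, c, a′, b′, c′` are
  (`quadRoot_semialgebraic`, `implicitDeriv_semialgebraic`; Bochnak–Coste–Roy 1998, Prop. 2.2.6).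

References: J. Bochnak, M. Coste, M.-F. Roy, *Real Algebraic Geometry* (1998), §2.2.
-/

noncomputable section

open Set Filter
open scoped Topology
open Literature.NumberTheory.Transcendental Literature.ModelTheory.ExponentialFields

namespace Summit.KontsevichZagierPeriods.IsogenyCertificates.RichelotChain

/-! ### Algebra of the two roots -/

/-- `x_ε = (−b + ε√D)/(2a)` satisfies `2a·x_ε + b = ε√D`. [folklore] -/
theorem two_mul_quadRoot_add (a b D ε : ℝ) (ha : a ≠ 0) :
    2 * a * ((-b + ε * Real.sqrt D) / (2 * a)) + b = ε * Real.sqrt D := by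
  field_simp
  ring

/-- `x_ε = (−b + ε√(b² − 4ac))/(2a)` is a root of `ax² + bx + c` when `a ≠ 0`, `b² − 4ac ≥ 0`,
`ε² = 1`. [folklore] -/
theorem quadRoot_isRoot (a b c ε : ℝ) (ha : a ≠ 0) (hD : 0 ≤ b ^ 2 - 4 * a * c) (hε : ε ^ 2 = 1) :
    a * ((-b + ε * Real.sqrt (b ^ 2 - 4 * a * c)) / (2 * a)) ^ 2 +
      b * ((-b + ε * Real.sqrt (b ^ 2 - 4 * a * c)) / (2 * a)) + c = 0 := by
  set s := Real.sqrt (b ^ 2 - 4 * a * c) with hs_def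
  have hs : s ^ 2 = b ^ 2 - 4 * a * c := Real.sq_sqrt hD
  have e : a * ((-b + ε * s) / (2 * a)) ^ 2 + b * ((-b + ε * s) / (2 * a)) + c =
      ((ε * s) ^ 2 - (b ^ 2 - 4 * a * c)) / (4 * a) := by
    field_simp
    ring
  rw [e, mul_pow, hε, one_mul, hs, sub_self, zero_div]

/-- Two roots of `ax² + bx + c` (`a ≠ 0`) are equal or sum to `−b/a`. [folklore] -/
theorem root_cases (a b c x₀ x : ℝ) (ha : a ≠ 0) (h₀ : a * x₀ ^ 2 + b * x₀ + c = 0)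
    (h : a * x ^ 2 + b * x + c = 0) : x = x₀ ∨ x = -b / a - x₀ := by
  have key : (x - x₀) * (a * (x + x₀) + b) = 0 := by linear_combination h - h₀
  rcases mul_eq_zero.mp key with h1 | h1
  · exact Or.inl (sub_eq_zero.mp h1)
  · right
    field_simp
    linarith

/-- If `a > 0`, `b² − 4ac > 0` and `y < y′` are roots of `ax² + bx + c`, then `y` is the root
`x₋ = (−b − √D)/(2a)` and `y′` is `x₊ = (−b + √D)/(2a)`. [folklore] -/
theorem roots_eq_of_lt (a b c y y' : ℝ) (ha : 0 < a) (hD : 0 < b ^ 2 - 4 * a * c)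
    (hy : a * y ^ 2 + b * y + c = 0) (hy' : a * y' ^ 2 + b * y' + c = 0) (hlt : y < y') :
    y = (-b + (-1) * Real.sqrt (b ^ 2 - 4 * a * c)) / (2 * a) ∧
      y' = (-b + 1 * Real.sqrt (b ^ 2 - 4 * a * c)) / (2 * a) := by
  set s := Real.sqrt (b ^ 2 - 4 * a * c) with hs_def
  have hs0 : 0 < s := Real.sqrt_pos.mpr hD
  have hplus : a * ((-b + 1 * s) / (2 * a)) ^ 2 + b * ((-b + 1 * s) / (2 * a)) + c = 0 :=
    quadRoot_isRoot a b c 1 ha.ne' hD.le (by norm_num)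
  have hsum : (-b + (-1) * s) / (2 * a) = -b / a - (-b + 1 * s) / (2 * a) := by
    field_simp
    ring
  have horder : (-b + (-1) * s) / (2 * a) < (-b + 1 * s) / (2 * a) := by
    rw [div_lt_div_iff_of_pos_right (by positivity)]
    linarith
  rcases root_cases a b c _ y ha.ne' hplus hy with h1 | h1 <;>
    rcases root_cases a b c _ y' ha.ne' hplus hy' with h2 | h2
  · exact absurd (h1.trans h2.symm) hlt.ne
  · rw [← hsum] at h2
    rw [h1, h2] at hlt
    exact absurd hlt (not_lt.mpr horder.le)
  · rw [← hsum] at h1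
    exact ⟨h1, h2⟩
  · exact absurd (h1.trans h2.symm) hlt.ne

/-! ### The derivative of a root, by implicit differentiation -/

/-- **Implicit differentiation of a simple root.** If `a, b, c` have derivatives `a₁, b₁, c₁` at
`t`, `a t ≠ 0` and `b t² − 4 a t c t > 0`, then the root `x_ε(u) = (−b u + ε√(b u² − 4a u c u))/(2a u)`
(`ε² = 1`) has derivative `−(a₁x² + b₁x + c₁)/(2 a t x + b t)` at `t`, where `x = x_ε(t)`.
[folklore] -/
theorem hasDerivAt_quadRoot (a b c : ℝ → ℝ) (a₁ b₁ c₁ t ε : ℝ) (hε : ε ^ 2 = 1)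
    (ha : HasDerivAt a a₁ t) (hb : HasDerivAt b b₁ t) (hc : HasDerivAt c c₁ t)
    (ha0 : a t ≠ 0) (hD : 0 < b t ^ 2 - 4 * a t * c t) :
    HasDerivAt (fun u => (-b u + ε * Real.sqrt (b u ^ 2 - 4 * a u * c u)) / (2 * a u))
      (-(a₁ * ((-b t + ε * Real.sqrt (b t ^ 2 - 4 * a t * c t)) / (2 * a t)) ^ 2 +
          b₁ * ((-b t + ε * Real.sqrt (b t ^ 2 - 4 * a t * c t)) / (2 * a t)) + c₁) /
        (2 * a t * ((-b t + ε * Real.sqrt (b t ^ 2 - 4 * a t * c t)) / (2 * a t)) + b t)) t := by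
  set ψ : ℝ → ℝ := fun u => (-b u + ε * Real.sqrt (b u ^ 2 - 4 * a u * c u)) / (2 * a u) with hψ
  set x : ℝ := (-b t + ε * Real.sqrt (b t ^ 2 - 4 * a t * c t)) / (2 * a t) with hx
  have hxψ : ψ t = x := rfl
  -- ψ is differentiable at t
  have hDd : HasDerivAt (fun u => b u ^ 2 - 4 * a u * c u)
      (2 * b t * b₁ - (4 * a₁ * c t + 4 * a t * c₁)) t := by
    have h := (hb.fun_mul hb).fun_sub ((ha.const_mul (4 : ℝ)).fun_mul hc)
    have e : (fun u => b u ^ 2 - 4 * a u * c u) = fun y => b y * b y - 4 * a y * c y := by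
      funext y
      ring
    rw [e]
    exact h.congr_deriv (by ring)
  have hdiff : DifferentiableAt ℝ ψ t := by
    have hnum : DifferentiableAt ℝ (fun u => -b u + ε * Real.sqrt (b u ^ 2 - 4 * a u * c u)) t :=
      hb.differentiableAt.neg.add ((hDd.differentiableAt.sqrt hD.ne').const_mul ε)
    have hden : DifferentiableAt ℝ (fun u => 2 * a u) t := ha.differentiableAt.const_mul 2
    exact hnum.div hden (mul_ne_zero two_ne_zero ha0)
  have hψ' : HasDerivAt ψ (deriv ψ t) t := hdiff.hasDerivAt
  set ψ₁ := deriv ψ t with hψ₁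
  -- near t, ψ is a root of the quadratic
  have hroot : ∀ᶠ u in 𝓝 t, a u * ψ u ^ 2 + b u * ψ u + c u = 0 := by
    have hDpos : ∀ᶠ u in 𝓝 t, 0 < b u ^ 2 - 4 * a u * c u :=
      hDd.continuousAt.eventually (lt_mem_nhds hD)
    have hane : ∀ᶠ u in 𝓝 t, a u ≠ 0 := ha.continuousAt.eventually_ne ha0
    filter_upwards [hDpos, hane] with u hu hu'
    exact quadRoot_isRoot (a u) (b u) (c u) ε hu' hu.le hε
  -- differentiate the identity
  have hF : HasDerivAt (fun u => a u * ψ u ^ 2 + b u * ψ u + c u)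
      (a₁ * ψ t ^ 2 + a t * (2 * ψ t * ψ₁) + (b₁ * ψ t + b t * ψ₁) + c₁) t := by
    have h := ((ha.fun_mul (hψ'.fun_mul hψ')).fun_add (hb.fun_mul hψ')).fun_add hc
    have e : (fun u => a u * ψ u ^ 2 + b u * ψ u + c u) =
        fun y => a y * (ψ y * ψ y) + b y * ψ y + c y := by
      funext y
      ring
    rw [e]
    exact h.congr_deriv (by ring)
  have hF0 : HasDerivAt (fun u => a u * ψ u ^ 2 + b u * ψ u + c u) 0 t := by
    refine (hasDerivAt_const t (0 : ℝ)).congr_of_eventuallyEq ?_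
    filter_upwards [hroot] with u hu
    simpa using hu
  have hzero : a₁ * ψ t ^ 2 + a t * (2 * ψ t * ψ₁) + (b₁ * ψ t + b t * ψ₁) + c₁ = 0 := hF.unique hF0
  -- solve for ψ₁
  have hden : 2 * a t * x + b t ≠ 0 := by
    rw [hx, two_mul_quadRoot_add _ _ _ _ ha0]
    have : ε ≠ 0 := by rintro rfl; norm_num at hε
    exact mul_ne_zero this (Real.sqrt_pos.mpr hD).ne'
  rw [hxψ] at hzero
  have hsol : ψ₁ = -(a₁ * x ^ 2 + b₁ * x + c₁) / (2 * a t * x + b t) := by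
    rw [eq_div_iff hden]
    linarith
  rw [← hsol]
  exact hψ'

/-- The implicit derivative `−(a′x² + b′x + c′)/(2ax + b)` does not vanish at a root `x` with
`2ax + b ≠ 0` as soon as `a′x² + b′x + c′ ≠ 0`. [folklore] -/
theorem implicitDeriv_ne_zero (a b a₁ b₁ c₁ x : ℝ) (hnum : a₁ * x ^ 2 + b₁ * x + c₁ ≠ 0)
    (hden : 2 * a * x + b ≠ 0) : -(a₁ * x ^ 2 + b₁ * x + c₁) / (2 * a * x + b) ≠ 0 :=
  div_ne_zero (neg_ne_zero.mpr hnum) hden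

/-! ### Semialgebraicity -/

variable {σ : Set (Fin 1 → ℝ)}

/-- The root `p ↦ x_ε(p 0)` is `ℚ`-semialgebraic on `σ` if the coefficients are (with Mathlib's junk
conventions for `√` of negatives and division by `0`, themselves semialgebraic).
[cite: BochnakCosteRoy1998, Prop. 2.2.6] -/
theorem quadRoot_semialgebraic (a b c : ℝ → ℝ) (ε : ℚ)
    (ha : IsSemialgebraicFunOn ℚ σ (fun p => a (p 0))) (hb : IsSemialgebraicFunOn ℚ σ (fun p => b (p 0)))
    (hc : IsSemialgebraicFunOn ℚ σ (fun p => c (p 0))) :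
    IsSemialgebraicFunOn ℚ σ
      (fun p => (-b (p 0) + (ε : ℝ) * Real.sqrt (b (p 0) ^ 2 - 4 * a (p 0) * c (p 0))) / (2 * a (p 0))) := by
  have hσ : IsSemialgebraic ℚ σ := IsSemialgebraicFunOn.isSemialgebraic_holds ha
  have hD : IsSemialgebraicFunOn ℚ σ (fun p => b (p 0) ^ 2 - 4 * a (p 0) * c (p 0)) :=
    (hb.fun_pow 2).fun_sub (((isSemialgebraicFunOn_const_ofNat hσ 4).fun_mul ha).fun_mul hc)
  have hnum : IsSemialgebraicFunOn ℚ σ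
      (fun p => -b (p 0) + (ε : ℝ) * Real.sqrt (b (p 0) ^ 2 - 4 * a (p 0) * c (p 0))) :=
    hb.fun_neg.fun_add ((isSemialgebraicFunOn_const_ratCast hσ ε).fun_mul hD.fun_sqrt)
  have hden : IsSemialgebraicFunOn ℚ σ (fun p => 2 * a (p 0)) :=
    (isSemialgebraicFunOn_const_ofNat hσ 2).fun_mul ha
  exact (hnum.fun_mul hden.fun_inv).congr fun p _ => by simp only [div_eq_mul_inv]

/-- The implicit derivative `p ↦ −(a′x² + b′x + c′)/(2ax + b)` at `x = X(p 0)` is `ℚ`-semialgebraic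
on `σ` if `a, b, a′, b′, c′` and `X` are. [cite: BochnakCosteRoy1998, Prop. 2.2.6] -/
theorem implicitDeriv_semialgebraic (a b a₁ b₁ c₁ X : ℝ → ℝ)
    (ha : IsSemialgebraicFunOn ℚ σ (fun p => a (p 0))) (hb : IsSemialgebraicFunOn ℚ σ (fun p => b (p 0)))
    (ha₁ : IsSemialgebraicFunOn ℚ σ (fun p => a₁ (p 0))) (hb₁ : IsSemialgebraicFunOn ℚ σ (fun p => b₁ (p 0)))
    (hc₁ : IsSemialgebraicFunOn ℚ σ (fun p => c₁ (p 0))) (hX : IsSemialgebraicFunOn ℚ σ (fun p => X (p 0))) :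
    IsSemialgebraicFunOn ℚ σ
      (fun p => -(a₁ (p 0) * X (p 0) ^ 2 + b₁ (p 0) * X (p 0) + c₁ (p 0)) /
        (2 * a (p 0) * X (p 0) + b (p 0))) := by
  have hσ : IsSemialgebraic ℚ σ := IsSemialgebraicFunOn.isSemialgebraic_holds ha
  have hnum : IsSemialgebraicFunOn ℚ σ
      (fun p => -(a₁ (p 0) * X (p 0) ^ 2 + b₁ (p 0) * X (p 0) + c₁ (p 0))) :=
    (((ha₁.fun_mul (hX.fun_pow 2)).fun_add (hb₁.fun_mul hX)).fun_add hc₁).fun_neg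
  have hden : IsSemialgebraicFunOn ℚ σ (fun p => 2 * a (p 0) * X (p 0) + b (p 0)) :=
    (((isSemialgebraicFunOn_const_ofNat hσ 2).fun_mul ha).fun_mul hX).fun_add hb
  exact (hnum.fun_mul hden.fun_inv).congr fun p _ => by simp only [div_eq_mul_inv]

/-- A polynomial expression `q(p 0)` given by an `MvPolynomial (Fin 1) ℚ` is `ℚ`-semialgebraic on any
`ℚ`-semialgebraic `σ ⊆ ℝ¹` (evaluation form used for the concrete coefficient polynomials).
[cite: BochnakCosteRoy1998, §2.2] -/
theorem poly_semialgebraic (hσ : IsSemialgebraic ℚ σ) (q : MvPolynomial (Fin 1) ℚ) (f : ℝ → ℝ)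
    (hf : ∀ x : ℝ, MvPolynomial.aeval (fun _ : Fin 1 => x) q = f x) :
    IsSemialgebraicFunOn ℚ σ (fun p => f (p 0)) := by
  refine (isSemialgebraicFunOn_aeval hσ q).congr fun p _ => ?_
  have hp : p = fun _ => p 0 := by funext i; rw [Fin.fin_one_eq_zero i]
  rw [← hf (p 0), ← hp]


/-! ### The trace over the two sheets -/

/-- **The two-sheet trace, from the certificates.** Abstract form of the computation behind
`trace(dζ/w) = κ·dx/y`: let `t₀ < x < t₁` where `t₀, t₁` are the two roots of
`Φ(x,·) = P t² + Q t + R` (so `P(t₀ + t₁) + Q = 0`), and suppose at both roots the norm identity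
`F(x)F̂(tⱼ) = Ψⱼ²` and the trace certificate `F(x)·∂ₓΦⱼ + κ(P(x + tⱼ) + Q)Ψⱼ = 0` hold, with
`F(x), F̂(tⱼ) ≠ 0`. Then the two push-forward weights `|∂ₓΦⱼ|/|∂_tΦⱼ| · (α + βtⱼ)/√|F̂(tⱼ)|`
(`∂_tΦⱼ = 2Ptⱼ + Q`) add up to `|κ|(α + βx)/√|F(x)|`. [cite: BostMestre1988, §2] -/
theorem trace_from_certs (x t₀ t₁ P Q Fx Fh₀ Fh₁ Ψ₀ Ψ₁ Φx₀ Φx₁ κ α β : ℝ)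
    (hP : P ≠ 0) (h₀ : t₀ < x) (h₁ : x < t₁) (hsum : P * (t₀ + t₁) + Q = 0)
    (hFx : Fx ≠ 0) (hFh₀ : Fh₀ ≠ 0) (hFh₁ : Fh₁ ≠ 0)
    (hn₀ : Fx * Fh₀ = Ψ₀ ^ 2) (hn₁ : Fx * Fh₁ = Ψ₁ ^ 2)
    (hc₀ : Fx * Φx₀ + κ * (P * (x + t₀) + Q) * Ψ₀ = 0)
    (hc₁ : Fx * Φx₁ + κ * (P * (x + t₁) + Q) * Ψ₁ = 0) :
    (α + β * t₀) / Real.sqrt |Fh₀| * (|Φx₀| / |2 * P * t₀ + Q|) +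
        (α + β * t₁) / Real.sqrt |Fh₁| * (|Φx₁| / |2 * P * t₁ + Q|) =
      |κ| * (α + β * x) / Real.sqrt |Fx| := by
  set s := Real.sqrt |Fx| with hs_def
  have hs0 : 0 < s := Real.sqrt_pos.mpr (abs_pos.mpr hFx)
  have hs2 : |Fx| = s ^ 2 := (Real.sq_sqrt (abs_nonneg Fx)).symm
  have ht : 0 < t₁ - t₀ := by linarith
  -- the linear algebra of the two roots
  have hd₀ : 2 * P * t₀ + Q = -(P * (t₁ - t₀)) := by linear_combination hsum
  have hd₁ : 2 * P * t₁ + Q = P * (t₁ - t₀) := by linear_combination hsum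
  have hu₀ : P * (x + t₀) + Q = -(P * (t₁ - x)) := by linear_combination hsum
  have hu₁ : P * (x + t₁) + Q = P * (x - t₀) := by linear_combination hsum
  -- Ψⱼ ≠ 0 and √|F̂ⱼ| = |Ψⱼ|/√|F|
  have hΨ₀ : Ψ₀ ≠ 0 := by
    intro h; rw [h] at hn₀; exact mul_ne_zero hFx hFh₀ (by simpa using hn₀)
  have hΨ₁ : Ψ₁ ≠ 0 := by
    intro h; rw [h] at hn₁; exact mul_ne_zero hFx hFh₁ (by simpa using hn₁)
  have hroot : ∀ {Fh Ψ : ℝ}, Fx * Fh = Ψ ^ 2 → Real.sqrt |Fh| = |Ψ| / s := by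
    intro Fh Ψ hn
    rw [eq_div_iff hs0.ne', hs_def, ← Real.sqrt_mul (abs_nonneg _), ← abs_mul, mul_comm, hn,
      abs_pow, Real.sqrt_sq (abs_nonneg _)]
  have hq₀ := hroot hn₀
  have hq₁ := hroot hn₁
  -- |∂ₓΦⱼ| from the trace certificate
  have hΦ₀ : |Φx₀| = |κ| * (|P| * (t₁ - x)) * |Ψ₀| / |Fx| := by
    rw [eq_div_iff (abs_ne_zero.mpr hFx), ← abs_of_pos (by linarith : (0 : ℝ) < t₁ - x),
      ← abs_mul, ← abs_mul, ← abs_mul, ← abs_mul]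
    rw [hu₀] at hc₀
    rw [show Φx₀ * Fx = κ * (P * (t₁ - x)) * Ψ₀ by linear_combination hc₀]
  have hΦ₁ : |Φx₁| = |κ| * (|P| * (x - t₀)) * |Ψ₁| / |Fx| := by
    rw [eq_div_iff (abs_ne_zero.mpr hFx), ← abs_of_pos (by linarith : (0 : ℝ) < x - t₀),
      ← abs_mul, ← abs_mul, ← abs_mul, ← abs_mul]
    rw [hu₁] at hc₁
    rw [show Φx₁ * Fx = -(κ * (P * (x - t₀)) * Ψ₁) by linear_combination hc₁, abs_neg]
  -- substitute and simplify
  have hPt : |2 * P * t₀ + Q| = |P| * (t₁ - t₀) := by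
    rw [hd₀, abs_neg, abs_mul, abs_of_pos ht]
  have hPt' : |2 * P * t₁ + Q| = |P| * (t₁ - t₀) := by
    rw [hd₁, abs_mul, abs_of_pos ht]
  rw [hq₀, hq₁, hΦ₀, hΦ₁, hPt, hPt', hs2]
  have hP' : |P| ≠ 0 := abs_ne_zero.mpr hP
  have hΨ₀' : |Ψ₀| ≠ 0 := abs_ne_zero.mpr hΨ₀
  have hΨ₁' : |Ψ₁| ≠ 0 := abs_ne_zero.mpr hΨ₁
  have ht' : t₁ - t₀ ≠ 0 := ht.ne'
  field_simp
  ring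

end Summit.KontsevichZagierPeriods.IsogenyCertificates.RichelotChain

end
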